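import Literature.MathematicalPhysics.QuantumFieldTheory.Balaban1983to89.Node00.CarriersB8Cube
import Literature.MathematicalPhysics.QuantumFieldTheory.Balaban1983to89.Node00.CarriersB8Sub

/-!
# NODE 00 — the Proposition-6 slot of record CUT DOWN to a sub-index: `ResidB8.withCubOn P`, `ResidB8.withCubSub` (director-ym R141 (A) «`B8.CubeData` member of record», second pin)

[Balaban1985RegularSpaces] = T. Bałaban, *Spaces of regular gauge field configurations on a lattice and gauge fixing conditions*, Commun. Math. Phys.
**99** (1985) 75–102, Sect. F pp. 98–99, Proposition 6; the admitted families p. 77 («T_η, η = L⁻ᵏ», (1.3)–(1.6)).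

WHAT THIS MODULE IS (seat `pub-ymgap-node00-def-cube` g3, 2026-08-26; APPEND-ONLY: a NEW importing module — `Node00/CarriersB8Cube` (the located slot
`ResidB8.withCub` over the FULL admitted index `IdxB8 θ = {Ω₀ = T}`) and `Node00/CarriersB8Sub` (g32's three located INDEX LAWS `IdxB8Laws`, the sub-index
`IdxB8Sub θ`) are untouched).  The [B8] FAMILY binder of the knit of record is already cut to print's own members (`withB8OfRecordSub` over `IdxB8Sub θ`);
this module gives the Proposition-6 slot `ResidB8.cub` the same cut:

* `ResidB8.withCubOn lam P` := the residual layer with `I8d := {i : IdxB8 θ // P i}` and `cub := fun i => cubB8OfRecord θ i.1`, for ANY predicate `P` on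
  the admitted index (so g32's laws `IdxB8Laws θ.L ·.1` — `ResidB8.withCubSub` — and any further located law, e.g. a bond law №12, are instances of ONE
  definition, with no import of the law's module); `rfl` faces; the two locators commute ∕ absorb (`withCub_withCubOn`, `withCubOn_withCub`).
* `prop6Printed_withCubOn_iff` ∕ `prop6Printed_withCubSub_iff` (`Iff.rfl`): what the hypothesis `p6 : B8.Prop6Printed θ.D θ.L lam.B₁ lam.c₁ lam.cub` of
  `Node00.b8LeafOfRecord_of_knit` READS at the cut layer — print's Proposition 6 as the unfolded `∀`-sentence over the law-abiding members only; a kernel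
  provider stated for an arbitrary re-indexing `f : ι → ZdIdx` feeds it at `f := fun i : {i // P i} => i.1.1`.
* restriction and monotonicity (theorems, bookkeeping): `prop6Printed_precomp` (re-indexing the Proposition-6 family along any map — the `_precomp` face
  the knit has for Thm 2 ∕ Thm 4 ∕ Prop. 3 ∕ Prop. 7 ∕ Thm 8), FULL ⇒ CUT (`prop6Printed_withCubOn_of_withCub`, never conversely), CUT-`P` ⇒ CUT-`Q` for
  `Q ⇒ P`; `GaugedBoundB8.mono` ((1.135)–(1.138)'s «≤ r» clauses are upward-closed in `r` for `η ≥ 0`) and `prop6Printed_zdCub_mono` (Proposition 6 with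
  constant `B₁` and threshold `c₁` implies it with any `B₁′ ≥ B₁`, `c₁′ ≤ c₁`), so a knit plug may take `lam.B₁ ≥` and `lam.c₁ ≤` a provider's constants.
* non-vacuity of the cut slot (answered at birth): `exists_idxB8Sub_cube_depth` — at every depth `k ≥ 1` the sub-index has a GENUINE member (n05-a's
  all-torus member at `η = L⁻ᵏ`, which obeys the laws by g32's `idxB8Laws_of_member_univ`) carrying a cube of Proposition 6 (`CubeB8.nonempty_of_univ`):
  the cut `∀` over (member, cube) does not range over an empty type.

HONEST FRAMING: DEFINITIONS and bookkeeping only — nothing of [Balaban1985RegularSpaces] is asserted or discharged here; whether the knit's per-cube sockets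
are satisfiable over the cut index is the suppliers' theorem, not claimed; N05 NOT discharged; counts unmoved; one finite T⁴ programme at fixed ε, Bałaban as
printed — NOT continuum ∕ ℝ⁴ ∕ infinite volume ∕ OS ∕ mass gap ∕ Clay.  No `sorry`, no `axiom`, no `opaque`, no `instance`, no `notation`. -/

noncomputable section

namespace Literature.MathematicalPhysics.QuantumFieldTheory.Balaban1983to89.Node00

open B7Prop1Explicit B7Prop2Explicit B8Ineq130
open B8LeafModelZd (ZdIdx)
open B8Ineq132 (InAk)

/-! ## §1. The Proposition-6 slot cut down to a predicate on the admitted index -/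

section CutSlot

variable {θ : Stage3Params}

/-- **THE RESIDUAL LAYER WITH ITS PROPOSITION-6 SLOT LOCATED OVER A SUB-INDEX**: `I8d := {i : IdxB8 θ // P i}`, `cub := fun i => cubB8OfRecord θ i.1`
(the member of record read through `Subtype.val`); every other residual datum unchanged.  Print's Proposition 6 is stated for its own admitted sequences
(p. 77: `T_η`, `η = L⁻ᵏ`, (1.3)–(1.6)); `P` names which admitted members those are. [cite: Balaban1985RegularSpaces, Prop. 6 p.99, p.77 («T_η, η = L^{−k}»; (1.3)–(1.6))] -/
def ResidB8.withCubOn (lam : ResidB8 θ) (P : IdxB8 θ → Prop) : ResidB8 θ :=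
  { lam with I8d := {i : IdxB8 θ // P i}, cub := fun i => cubB8OfRecord θ i.1 }

/-- The cut layer's Proposition-6 index is the subtype `{i : IdxB8 θ // P i}`. [cite: Balaban1985RegularSpaces, Prop. 6 p.99] -/
theorem ResidB8.withCubOn_I8d (lam : ResidB8 θ) (P : IdxB8 θ → Prop) : (lam.withCubOn P).I8d = {i : IdxB8 θ // P i} := rfl
/-- The cut layer's Proposition-6 members are the members of record through `Subtype.val`. [cite: Balaban1985RegularSpaces, Prop. 6 p.99] -/
theorem ResidB8.withCubOn_cub (lam : ResidB8 θ) (P : IdxB8 θ → Prop) : (lam.withCubOn P).cub = fun i : {i : IdxB8 θ // P i} => cubB8OfRecord θ i.1 := rfl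
/-- … member by member: `zdCub θ.𝔸 θ.L i.1.1`. [cite: Balaban1985RegularSpaces, Prop. 6 p.99] -/
theorem ResidB8.withCubOn_cub_apply (lam : ResidB8 θ) (P : IdxB8 θ → Prop) (i : {i : IdxB8 θ // P i}) :
    (lam.withCubOn P).cub i = zdCub θ.𝔸 θ.L i.1.1 := rfl
/-- Cutting the Proposition-6 slot leaves the Hölder exponent unchanged. [cite: Balaban1985RegularSpaces, Thm 2 p.83, Prop. 6 p.99] -/
theorem ResidB8.withCubOn_β (lam : ResidB8 θ) (P : IdxB8 θ → Prop) : (lam.withCubOn P).β = lam.β := rfl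
/-- … and the length function of [4] (3.40). [cite: Balaban1985RegularSpaces, Thm 2 p.83, Prop. 6 p.99] -/
theorem ResidB8.withCubOn_len (lam : ResidB8 θ) (P : IdxB8 θ → Prop) : (lam.withCubOn P).len = lam.len := rfl
/-- … and the Proposition-5 index. [cite: Balaban1985RegularSpaces, Prop. 5 p.94, Prop. 6 p.99] -/
theorem ResidB8.withCubOn_I8c (lam : ResidB8 θ) (P : IdxB8 θ → Prop) : (lam.withCubOn P).I8c = lam.I8c := rfl
/-- … and the [Balaban1985BackgroundPropagators] inputs `B₀, B₀′`. [cite: Balaban1985RegularSpaces, Prop. 6 p.99] -/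
theorem ResidB8.withCubOn_inp (lam : ResidB8 θ) (P : IdxB8 θ → Prop) : (lam.withCubOn P).inp = lam.inp := rfl
/-- … and the constant `B₁` of (1.136). [cite: Balaban1985RegularSpaces, Prop. 6 (1.136) p.99] -/
theorem ResidB8.withCubOn_B₁ (lam : ResidB8 θ) (P : IdxB8 θ → Prop) : (lam.withCubOn P).B₁ = lam.B₁ := rfl
/-- … and the threshold `c₁` of «7dL²Mα₀ ≤ c₁». [cite: Balaban1985RegularSpaces, Prop. 6 p.99] -/
theorem ResidB8.withCubOn_c₁ (lam : ResidB8 θ) (P : IdxB8 θ → Prop) : (lam.withCubOn P).c₁ = lam.c₁ := rfl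
/-- … and `C₂, B₁′, B₂, B₀(β₀)`. [cite: Balaban1985RegularSpaces, Prop. 3 p.87, Thm 4 p.88, Thm 8 p.101] -/
theorem ResidB8.withCubOn_consts (lam : ResidB8 θ) (P : IdxB8 θ → Prop) :
    (lam.withCubOn P).C₂ = lam.C₂ ∧ (lam.withCubOn P).B₁' = lam.B₁' ∧ (lam.withCubOn P).B₂ = lam.B₂ ∧ (lam.withCubOn P).B₀β = lam.B₀β :=
  ⟨rfl, rfl, rfl, rfl⟩
/-- Locating first over the full index and then cutting is cutting (`rfl`). [cite: Balaban1985RegularSpaces, Prop. 6 p.99 (bookkeeping)] -/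
theorem ResidB8.withCub_withCubOn (lam : ResidB8 θ) (P : IdxB8 θ → Prop) : lam.withCub.withCubOn P = lam.withCubOn P := rfl
/-- Cutting and then locating over the full index is locating over the full index (`rfl`). [cite: Balaban1985RegularSpaces, Prop. 6 p.99 (bookkeeping)] -/
theorem ResidB8.withCubOn_withCub (lam : ResidB8 θ) (P : IdxB8 θ → Prop) : (lam.withCubOn P).withCub = lam.withCub := rfl
/-- Cutting twice is cutting by the second predicate (`rfl`). [cite: Balaban1985RegularSpaces, Prop. 6 p.99 (bookkeeping)] -/
theorem ResidB8.withCubOn_withCubOn (lam : ResidB8 θ) (P Q : IdxB8 θ → Prop) : (lam.withCubOn P).withCubOn Q = lam.withCubOn Q := rfl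

/-- **THE PROPOSITION-6 SLOT OVER THE SUB-INDEX OF RECORD** `IdxB8Sub θ` (g32's three located laws: №7 `Lᵏη ≤ 1`, №8 truncation, №11 the graded cover
(1.6)). [cite: Balaban1985RegularSpaces, Prop. 6 p.99, p.77, (1.6) p.77, (1.19) p.79, (1.34) p.82] -/
abbrev ResidB8.withCubSub (lam : ResidB8 θ) : ResidB8 θ :=
  lam.withCubOn fun i => IdxB8Laws θ.L i.1

/-- The sub-index layer's Proposition-6 index IS `IdxB8Sub θ` (`rfl`). [cite: Balaban1985RegularSpaces, Prop. 6 p.99 (bookkeeping)] -/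
theorem ResidB8.withCubSub_I8d (lam : ResidB8 θ) : lam.withCubSub.I8d = IdxB8Sub θ := rfl
/-- … with members `i ↦ cubB8OfRecord θ i.1`. [cite: Balaban1985RegularSpaces, Prop. 6 p.99 (bookkeeping)] -/
theorem ResidB8.withCubSub_cub (lam : ResidB8 θ) : lam.withCubSub.cub = fun i : IdxB8Sub θ => cubB8OfRecord θ i.1 := rfl

/-- **WHAT `p6` OF `b8LeafOfRecord_of_knit` READS AT THE CUT LAYER**: `B8.Prop6Printed θ.D θ.L lam.B₁ lam.c₁ (lam.withCubOn P).cub` is the unfolded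
`∀`-sentence over `{i : IdxB8 θ // P i}` — for every such member, every `α₀ > 0`, every unitary `U₀ ∈ 𝔄_k({Ω_j}, α₀)` and every cube with «7dL²Mα₀ ≤ c₁»,
(1.135)–(1.138) with `7dL²B₁Mα₀`. [cite: Balaban1985RegularSpaces, Prop. 6 p.99] -/
theorem prop6Printed_withCubOn_iff (lam : ResidB8 θ) (P : IdxB8 θ → Prop) :
    B8.Prop6Printed θ.D (θ.L : ℝ) (lam.withCubOn P).B₁ (lam.withCubOn P).c₁ (lam.withCubOn P).cub ↔
      ∀ i : {i : IdxB8 θ // P i}, ∀ α₀ : ℝ, 0 < α₀ → ∀ U₀ : {U : B7Prop1Explicit.Site θ.D → Fin θ.D → θ.𝔸ˣ // ∀ x κ, U x κ ∈ unitaryUnits θ.𝔸},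
        InAk θ.L i.1.1.k i.1.1.η α₀ i.1.1.Ω U₀.1 → ∀ c : CubeB8 θ.D θ.L i.1.1.k i.1.1.Ω, 7 * θ.D * (θ.L : ℝ) ^ 2 * c.M * α₀ ≤ lam.c₁ →
          GaugedBoundB8 θ.L i.1.1.η U₀.1 c (7 * θ.D * (θ.L : ℝ) ^ 2 * lam.B₁ * c.M * α₀) := Iff.rfl

/-- … and at the sub-index of record: the same sentence over `IdxB8Sub θ`. [cite: Balaban1985RegularSpaces, Prop. 6 p.99] -/
theorem prop6Printed_withCubSub_iff (lam : ResidB8 θ) :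
    B8.Prop6Printed θ.D (θ.L : ℝ) lam.withCubSub.B₁ lam.withCubSub.c₁ lam.withCubSub.cub ↔
      ∀ i : IdxB8Sub θ, ∀ α₀ : ℝ, 0 < α₀ → ∀ U₀ : {U : B7Prop1Explicit.Site θ.D → Fin θ.D → θ.𝔸ˣ // ∀ x κ, U x κ ∈ unitaryUnits θ.𝔸},
        InAk θ.L i.1.1.k i.1.1.η α₀ i.1.1.Ω U₀.1 → ∀ c : CubeB8 θ.D θ.L i.1.1.k i.1.1.Ω, 7 * θ.D * (θ.L : ℝ) ^ 2 * c.M * α₀ ≤ lam.c₁ →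
          GaugedBoundB8 θ.L i.1.1.η U₀.1 c (7 * θ.D * (θ.L : ℝ) ^ 2 * lam.B₁ * c.M * α₀) := Iff.rfl

/-- The cut slot's `p6` letter IS `B8.Prop6Printed` on the `zdCub` family re-indexed along `fun i : {i // P i} => i.1.1` — the shape in which a kernel
provider stated for an arbitrary `f : ι → ZdIdx` is applied (`Iff.rfl`). [cite: Balaban1985RegularSpaces, Prop. 6 p.99 (bookkeeping)] -/
theorem prop6Printed_withCubOn_iff_zdCub (lam : ResidB8 θ) (P : IdxB8 θ → Prop) (B₁ c₁ : ℝ) :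
    B8.Prop6Printed θ.D (θ.L : ℝ) B₁ c₁ (lam.withCubOn P).cub ↔
      B8.Prop6Printed θ.D (θ.L : ℝ) B₁ c₁ (fun i : {i : IdxB8 θ // P i} => zdCub θ.𝔸 θ.L i.1.1) := Iff.rfl

end CutSlot

/-! ## §2. Restriction and monotonicity (bookkeeping theorems) -/

section Restrict

/-- **RE-INDEXING THE PROPOSITION-6 FAMILY** along any map `e : J → I` preserves `B8.Prop6Printed` (member by member; the `_precomp` face of
`B8LeafKnit` for Thm 2 ∕ Thm 4 ∕ Prop. 3 ∕ Prop. 7 ∕ Thm 8, here for Prop. 6). [cite: Balaban1985RegularSpaces, Prop. 6 p.99 (bookkeeping: restriction of the family index)] -/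
theorem prop6Printed_precomp {I J : Type} (e : J → I) (d : ℕ) (L B₁ c₁ : ℝ) (fam : I → B8.CubeData) (h : B8.Prop6Printed d L B₁ c₁ fam) :
    B8.Prop6Printed d L B₁ c₁ (fun j => fam (e j)) :=
  fun j => h (e j)

variable {θ : Stage3Params}

/-- **FULL ⇒ CUT**: Proposition 6 over the whole admitted index gives it over any sub-index (never conversely). [cite: Balaban1985RegularSpaces, Prop. 6 p.99 (bookkeeping)] -/
theorem prop6Printed_withCubOn_of_withCub (lam : ResidB8 θ) (P : IdxB8 θ → Prop) (B₁ c₁ : ℝ)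
    (h : B8.Prop6Printed θ.D (θ.L : ℝ) B₁ c₁ lam.withCub.cub) : B8.Prop6Printed θ.D (θ.L : ℝ) B₁ c₁ (lam.withCubOn P).cub :=
  fun i => h i.1

/-- **CUT-`P` ⇒ CUT-`Q`** whenever `Q ⇒ P` (a smaller sub-index asks less). [cite: Balaban1985RegularSpaces, Prop. 6 p.99 (bookkeeping)] -/
theorem prop6Printed_withCubOn_mono (lam : ResidB8 θ) {P Q : IdxB8 θ → Prop} (hQP : ∀ i, Q i → P i) (B₁ c₁ : ℝ)
    (h : B8.Prop6Printed θ.D (θ.L : ℝ) B₁ c₁ (lam.withCubOn P).cub) : B8.Prop6Printed θ.D (θ.L : ℝ) B₁ c₁ (lam.withCubOn Q).cub :=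
  fun i => h ⟨i.1, hQP i.1 i.2⟩

end Restrict

section Mono

variable {d : ℕ} {𝔸 : Type*} [CStarAlgebra 𝔸]

/-- **(1.135)–(1.138)'s «≤ r» CLAUSES ARE UPWARD-CLOSED IN `r`** for a spacing `η ≥ 0`: the same gauge transformation witnesses `GaugedBoundB8 … r′` for every
`r′ ≥ r` ((1.136)₁'s bound `r·(Lʲη)⁻¹` and the three scaled sup norms). [cite: Balaban1985RegularSpaces, Prop. 6 (1.136) p.99 (bookkeeping)] -/
theorem GaugedBoundB8.mono {L K : ℕ} {Ω : ℕ → Set (B7Prop1Explicit.Site d)} {η : ℝ} (hη : 0 ≤ η) {U₀ : B7Prop1Explicit.Site d → Fin d → 𝔸ˣ}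
    {c : CubeB8 d L K Ω} {r r' : ℝ} (hr : r ≤ r') (h : GaugedBoundB8 L η U₀ c r) : GaugedBoundB8 L η U₀ c r' := by
  obtain ⟨u, hu, huS, h129, h138, h162, hw, h135, h136₂, h136₃, h136₄, h137⟩ := h
  refine ⟨u, hu, huS, h129, h138, fun j hj b hb => ?_, hw, h135, h136₂.trans hr, h136₃.trans hr, h136₄.trans hr, h137⟩
  obtain ⟨h₁, h₂, h₃⟩ := h162 j hj b hb
  exact ⟨h₁, h₂, h₃.trans (mul_le_mul_of_nonneg_right hr (inv_nonneg.mpr (mul_nonneg (pow_nonneg (Nat.cast_nonneg _) _) hη)))⟩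

end Mono

section MonoConsts

variable {d : ℕ} (𝔸 : Type) [CStarAlgebra 𝔸]

/-- **PROPOSITION 6 WITH `(B₁, c₁)` GIVES IT WITH ANY `B₁′ ≥ B₁`, `c₁′ ≤ c₁`** on the `zdCub` family (fewer cubes qualify under the smaller threshold; the
bound `7dL²B₁Mα₀` grows with `B₁`). [cite: Balaban1985RegularSpaces, Prop. 6 p.99 (bookkeeping)] -/
theorem prop6Printed_zdCub_mono {L : ℕ} {ι : Type} (f : ι → ZdIdx d L) {B₁ B₁' c₁ c₁' : ℝ} (hB : B₁ ≤ B₁') (hc : c₁' ≤ c₁)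
    (h : B8.Prop6Printed d (L : ℝ) B₁ c₁ (fun j => zdCub 𝔸 L (f j))) : B8.Prop6Printed d (L : ℝ) B₁' c₁' (fun j => zdCub 𝔸 L (f j)) := by
  rw [prop6Printed_zdCub_iff] at h ⊢
  intro j α₀ hα U₀ hU c hs
  refine (h j α₀ hα U₀ hU c (hs.trans hc)).mono (f j).hη.le ?_
  have h7 : (0 : ℝ) ≤ 7 * d * (L : ℝ) ^ 2 := by positivity
  exact mul_le_mul_of_nonneg_right (mul_le_mul_of_nonneg_right (mul_le_mul_of_nonneg_left hB h7) (Nat.cast_nonneg _)) hα.le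

variable {𝔸} {θ : Stage3Params}

/-- … on the member of record over any sub-index: a knit plug may take `lam.B₁ ≥` and `lam.c₁ ≤` a provider's constants.
[cite: Balaban1985RegularSpaces, Prop. 6 p.99 (bookkeeping)] -/
theorem prop6Printed_withCubOn_mono_consts (lam : ResidB8 θ) (P : IdxB8 θ → Prop) {B₁ B₁' c₁ c₁' : ℝ} (hB : B₁ ≤ B₁') (hc : c₁' ≤ c₁)
    (h : B8.Prop6Printed θ.D (θ.L : ℝ) B₁ c₁ (lam.withCubOn P).cub) : B8.Prop6Printed θ.D (θ.L : ℝ) B₁' c₁' (lam.withCubOn P).cub :=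
  prop6Printed_zdCub_mono θ.𝔸 (fun i : {i : IdxB8 θ // P i} => i.1.1) hB hc h

/-- … and over the full admitted index. [cite: Balaban1985RegularSpaces, Prop. 6 p.99 (bookkeeping)] -/
theorem prop6Printed_cubB8OfRecord_mono {B₁ B₁' c₁ c₁' : ℝ} (hB : B₁ ≤ B₁') (hc : c₁' ≤ c₁)
    (h : B8.Prop6Printed θ.D (θ.L : ℝ) B₁ c₁ (cubB8OfRecord θ)) : B8.Prop6Printed θ.D (θ.L : ℝ) B₁' c₁' (cubB8OfRecord θ) :=
  prop6Printed_zdCub_mono θ.𝔸 (fun i : IdxB8 θ => i.1) hB hc h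

end MonoConsts

/-! ## §3. Non-vacuity of the cut slot: law-abiding members carrying cubes exist at every depth -/

section NonVacuity

variable (θ : Stage3Params)

/-- **THE CUT `∀` IS NOT OVER AN EMPTY TYPE**: at every depth `k ≥ 1` the sub-index of record has a genuine member (n05-a's all-torus member at
`η = L⁻ᵏ`, `Ω_j = T` for all `j`, obeying the three laws by `idxB8Laws_of_member_univ`) which carries a cube of Proposition 6 (`CubeB8.nonempty_of_univ`:
«□ ⊂ Ω_k», «□̃ ⊂ Ω_{k−1}» automatic). [cite: Balaban1985RegularSpaces, p.77 («we admit Ω_j = T_η»), p.98 («Now let us take a cube □ ⊂ Ω₀ …») (bookkeeping: the cut slot is inhabited)] -/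
theorem exists_idxB8Sub_cube_depth {k : ℕ} (hk : 1 ≤ k) :
    ∃ i : IdxB8Sub θ, i.1.1.k = k ∧ Nonempty (CubeB8 θ.D θ.L i.1.1.k i.1.1.Ω) := by
  have hL : 1 ≤ θ.L := le_trans (by norm_num) θ.two_le_L
  have hD : 1 ≤ θ.D := by have := θ.hd₆; omega
  have hη : (0 : ℝ) < ((θ.L : ℝ)⁻¹) ^ k := pow_pos (inv_pos.mpr (by exact_mod_cast (show 0 < θ.L by omega))) k
  obtain ⟨i, h0, hik, hiη, hΩ, hΛ, -⟩ := B8LeafModelZd3NonVacuity.exists_member_univ (d := θ.D) hL hk hη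
  exact ⟨⟨⟨i, h0⟩, idxB8Laws_of_member_univ hL (by rw [hiη, hik]) hΛ⟩, hik, CubeB8.nonempty_of_univ hD i.hk (hΩ _) (hΩ _)⟩

/-- … in particular some law-abiding member carries a cube. [cite: Balaban1985RegularSpaces, p.77, p.98 (bookkeeping)] -/
theorem exists_idxB8Sub_cube : ∃ i : IdxB8Sub θ, Nonempty (CubeB8 θ.D θ.L i.1.1.k i.1.1.Ω) :=
  let ⟨i, _, hc⟩ := exists_idxB8Sub_cube_depth θ le_rfl
  ⟨i, hc⟩

/-- … and, for any predicate holding at that member's laws, the cut index `{i // P i}` has a member with a cube (e.g. `P := IdxB8Laws θ.L ·.1` itself).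
[cite: Balaban1985RegularSpaces, p.77, p.98 (bookkeeping)] -/
theorem exists_cut_cube_of_laws {P : IdxB8 θ → Prop} (hP : ∀ i : IdxB8 θ, IdxB8Laws θ.L i.1 → P i) :
    ∃ i : {i : IdxB8 θ // P i}, Nonempty (CubeB8 θ.D θ.L i.1.1.k i.1.1.Ω) :=
  let ⟨i, hc⟩ := exists_idxB8Sub_cube θ
  ⟨⟨i.1, hP i.1 i.2⟩, hc⟩

end NonVacuity

end Literature.MathematicalPhysics.QuantumFieldTheory.Balaban1983to89.Node00
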